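import Literature.NumberTheory.EllipticCurves.RankinSelbergEulerProductHeckeProofs
import Literature.NumberTheory.EllipticCurves.TwistedLSeriesEulerProductProofs
import Literature.NumberTheory.NumberFields.PrimesOverRegroup
import Literature.NumberTheory.GaloisRepresentations.GlobalArtinMapNormProofs
import HarnessLib

/-!
# The Rankin–Selberg Euler product of `f` over `K` regrouped by rational primes, and the
# assembly step of the Artin formalism `L(s, f_K ⊗ φ) = L(f ⊗ χ₁, s) · L(f ⊗ χ₂, s)`

Topic `NumberTheory/EllipticCurves` (namespace `Literature.NumberTheory.EllipticCurves`). Everything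
here is PROVED (theorems only, no definitions, no named facts).

This is the GLOBAL (analytic) half of a discharge of the named fact
`Literature.NumberTheory.EllipticCurves.rankinSelbergEulerProductHecke_baseChangeDirichlet_eq`
(`RankinSelbergBaseChangeDirichlet.lean`): the identity
`rankinSelbergEulerProductHecke f φ s = twistedLSeries f χ₁ s · twistedLSeries f χ₂ s` (`re s > 2`)
is reduced to a purely LOCAL hypothesis — for every rational prime `p`, the finite product of the
inverse Rankin–Selberg local factors over the primes `v ∣ p` of `K` equals the product of the
`p`-Euler factors of the two twisted `L`-series (`rankinSelbergEulerProductHecke_eq_mul_of_local`).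
The proof is the tree's proof of `ζ_K = ζ · L(κ)`
(`QuadraticFields/QuadraticDedekindZetaKronecker.lean`, Neukirch VII (5.12) pattern) with the
Dedekind Euler factors replaced by the Rankin–Selberg ones:

* `HasProd.primesOver_regroup_spectrum` — regrouping of an unconditionally convergent product over
  `HeightOneSpectrum (𝓞 K)` by the rational prime below, for factors depending on the PLACE `v`
  (not only on `N(v)`), the inner finite product being over
  `HeightOneSpectrum.asIdeal ⁻¹' primesOver pℤ` (a `HasProd.sigma` along
  `Literature.NumberTheory.NumberFields.toNatPrimes`, as in `HasProd.primesOver_regroup`);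
* `HeckeCharacter.IsFiniteOrder.compRelNorm` — `ω ∘ N_{E/F}` has finite order when `ω` has, so the
  Euler product of `hasProd_rankinSelbergEulerProductHecke_of_isFiniteOrder` applies to
  `φ = (HeckeCharacter.ofDirichlet θ).compRelNorm K`;
* `rankinSelbergEulerProductHecke_eq_mul_of_local` and its specialisation
  `rankinSelbergEulerProductHecke_baseChange_eq_mul_of_local` to `φ = ψ_θ ∘ N_{K/ℚ}`.

What remains for `…_baseChangeDirichlet_eq_holds` is the local bookkeeping at each `p` (split /
inert / ramified / `p ∣ m`; algebra already in `TwistedLSeriesEulerProductProofs.lean`,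
`inert_localFactor_mul`, `split_localFactor_sq`) together with the Hecke values
`heckeValueExtZero (ψ_θ ∘ N) v = θ(p)^{f_v}` resp. `0`.

## References

* [Gross2004] B. H. Gross, *Heegner points and representation theory*, in *Heegner Points and
  Rankin L-Series*, MSRI Publ. 49 (2004), §3 (p. 40), §13 (p. 49).
* [NeukirchANT1999] J. Neukirch, *Algebraic Number Theory* (1999), Ch. VII (5.12) and (10.4)(iv).
* [Shimura1971] G. Shimura, *Introduction to the Arithmetic Theory of Automorphic Functions*
  (1971), Thm. 3.66 (twisted Euler products).
-/

noncomputable section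

open scoped MatrixGroups ModularForm Topology
open CongruenceSubgroup NumberField IsDedekindDomain Ideal Complex
open Literature.NumberTheory.GaloisRepresentations
open Literature.NumberTheory.EllipticCurves.ModularForms
open Literature.NumberTheory.NumberFields

universe u

namespace Literature.NumberTheory.EllipticCurves

/-! ### Finite order is preserved by base change along the norm -/

section FiniteOrder

variable {F : Type} (E : Type) [Field F] [Field E] [Algebra F E] [NumberField F] [NumberField E]
  [IsGalois F E]

/-- **`ω ∘ N_{E/F}` has finite order if `ω` has** (`(ω ∘ N)^n = ω^n ∘ N`; base change of Hecke
characters along the norm, Tate in Cassels–Fröhlich VII §4.3). [cite: CasselsFrohlichANT1967, Ch. VII Prop. 4.3] -/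
theorem HeckeCharacter.IsFiniteOrder.compRelNorm {ω : HeckeCharacter F} (h : ω.IsFiniteOrder) :
    (ω.compRelNorm E).IsFiniteOrder := by
  obtain ⟨n, hn, hωn⟩ := (isOfFinOrder_iff_pow_eq_one).1 h
  refine (isOfFinOrder_iff_pow_eq_one).2 ⟨n, hn, ?_⟩
  refine HeckeCharacter.ext fun y => ?_
  rw [HeckeCharacter.pow_apply, HeckeCharacter.compRelNorm_apply, ← HeckeCharacter.pow_apply, hωn,
    HeckeCharacter.one_apply, HeckeCharacter.one_apply]

end FiniteOrder

/-! ### Regrouping a product over the places of `K` by the rational prime below -/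

section Regroup

variable {K : Type u} [Field K] [NumberField K]

omit [NumberField K] in
/-- The fibre of `toNatPrimes` over `p` is the set of places whose ideal lies over `pℤ` (the primes
`𝔭 ∣ p`, Neukirch I §8). [cite: NeukirchANT1999, Ch. I §8 (8.1)–(8.2)] -/
theorem setOf_toNatPrimes_eq_preimage_primesOver (p : Nat.Primes) :
    {v : HeightOneSpectrum (𝓞 K) | toNatPrimes v = p} =
      HeightOneSpectrum.asIdeal ⁻¹' primesOver (span {((p : ℕ) : ℤ)}) (𝓞 K) := by
  ext v
  rw [Set.mem_setOf_eq, Set.mem_preimage, mem_primesOver_iff_natPrimeUnder v.isPrime]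
  constructor
  · intro h
    exact congrArg Subtype.val h
  · intro h
    exact Subtype.ext h

/-- `primesOver pℤ` (`p` prime) consists of nonzero primes, i.e. lies in the range of
`HeightOneSpectrum.asIdeal`. [cite: NeukirchANT1999, Ch. I §8 (8.1)–(8.2)] -/
theorem primesOver_subset_range_asIdeal {p : ℕ} (hp : p.Prime) :
    primesOver (span {(p : ℤ)}) (𝓞 K) ⊆ Set.range (HeightOneSpectrum.asIdeal (R := 𝓞 K)) :=
  fun P hP => ⟨⟨P, hP.1, ne_bot_of_mem_primesOver hp hP⟩, rfl⟩

/-- The number of places over `pℤ` is the number `r` of primes `𝔭 ∣ p`.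
[cite: NeukirchANT1999, Ch. I §8 (8.2)] -/
theorem ncard_preimage_primesOver {p : ℕ} (hp : p.Prime) :
    (HeightOneSpectrum.asIdeal ⁻¹' primesOver (span {(p : ℤ)}) (𝓞 K)).ncard =
      (primesOver (span {(p : ℤ)}) (𝓞 K)).ncard :=
  Set.ncard_preimage_of_injective_subset_range (fun _ _ h => HeightOneSpectrum.ext h)
    (primesOver_subset_range_asIdeal hp)

/-- A `finprod` over the places over `pℤ` is the `finprod` over `primesOver pℤ` of any extension of
the factor to ideals (the finite product `∏_{𝔭 ∣ p}`). [cite: NeukirchANT1999, Ch. I §8 (8.2)] -/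
theorem finprod_mem_preimage_primesOver_eq {M : Type*} [CommMonoid M] {p : ℕ} (hp : p.Prime)
    (g : HeightOneSpectrum (𝓞 K) → M) (G : Ideal (𝓞 K) → M) (hG : ∀ v, G v.asIdeal = g v) :
    ∏ᶠ v ∈ HeightOneSpectrum.asIdeal ⁻¹' primesOver (span {(p : ℤ)}) (𝓞 K), g v =
      ∏ᶠ P ∈ primesOver (span {(p : ℤ)}) (𝓞 K), G P := by
  have hinj : Set.InjOn (HeightOneSpectrum.asIdeal (R := 𝓞 K))
      (HeightOneSpectrum.asIdeal ⁻¹' primesOver (span {(p : ℤ)}) (𝓞 K)) :=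
    fun _ _ _ _ h => HeightOneSpectrum.ext h
  have himage : HeightOneSpectrum.asIdeal ''
      (HeightOneSpectrum.asIdeal ⁻¹' primesOver (span {(p : ℤ)}) (𝓞 K)) =
      primesOver (span {(p : ℤ)}) (𝓞 K) :=
    Set.image_preimage_eq_of_subset (primesOver_subset_range_asIdeal hp)
  rw [show ∏ᶠ P ∈ primesOver (span {(p : ℤ)}) (𝓞 K), G P =
      ∏ᶠ P ∈ HeightOneSpectrum.asIdeal ''
        (HeightOneSpectrum.asIdeal ⁻¹' primesOver (span {(p : ℤ)}) (𝓞 K)), G P by rw [himage],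
    finprod_mem_image hinj]
  exact finprod_mem_congr rfl fun v _ => (hG v).symm

/-- **Regrouping an unconditionally convergent product over the places of `K` by the rational prime
below**, for factors depending on the place: if `∏_v g(v) = a` unconditionally over
`HeightOneSpectrum (𝓞 K)`, then `∏_p (∏_{v ∣ p} g(v)) = a` unconditionally over the rational primes,
the inner product being the finite product over `asIdeal ⁻¹' primesOver pℤ`.
[cite: NeukirchANT1999, Ch. VII (5.12)] -/
theorem HasProd.primesOver_regroup_spectrum {g : HeightOneSpectrum (𝓞 K) → ℂ} {a : ℂ}
    (h : HasProd g a) :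
    HasProd (fun p : Nat.Primes =>
      ∏ᶠ v ∈ HeightOneSpectrum.asIdeal ⁻¹' primesOver (span {((p : ℕ) : ℤ)}) (𝓞 K), g v) a := by
  classical
  -- extend `g` to all ideals (value `1` off the nonzero primes) and regroup with the tree lemma
  set G : Ideal (𝓞 K) → ℂ := fun P =>
    if hP : P.IsPrime ∧ P ≠ ⊥ then g ⟨P, hP.1, hP.2⟩ else 1 with hGdef
  have hG : ∀ v : HeightOneSpectrum (𝓞 K), G v.asIdeal = g v := fun v => by
    rw [hGdef]
    dsimp only
    rw [dif_pos ⟨v.isPrime, v.ne_bot⟩]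
  have h1 : HasProd (fun v : HeightOneSpectrum (𝓞 K) => G v.asIdeal) a := by
    rwa [show (fun v : HeightOneSpectrum (𝓞 K) => G v.asIdeal) = g from funext hG]
  have h2 := Literature.NumberTheory.NumberFields.HasProd.primesOver_regroup h1
  rwa [show (fun p : Nat.Primes => ∏ᶠ P ∈ primesOver (span {((p : ℕ) : ℤ)}) (𝓞 K), G P) =
      fun p : Nat.Primes =>
        ∏ᶠ v ∈ HeightOneSpectrum.asIdeal ⁻¹' primesOver (span {((p : ℕ) : ℤ)}) (𝓞 K), g v from
    funext fun p => (finprod_mem_preimage_primesOver_eq p.2 g G hG).symm] at h2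

/-- The regrouped Rankin–Selberg Euler product: for `f ∈ S₂(Γ₀(N))`, a finite-order Hecke character
`φ` of `K` and `re s > 2`, `∏_p (∏_{v ∣ p} F_v(s)⁻¹)` converges unconditionally to
`rankinSelbergEulerProductHecke f φ s`. [cite: Gross2004, §3 (p. 40)] -/
theorem hasProd_rankinSelbergEulerProductHecke_regroup {N : ℕ} [NeZero N] (f : CuspForm (Gamma0 N) 2)
    {φ : HeckeCharacter K} (hφ : φ.IsFiniteOrder) {s : ℂ} (hs : 2 < s.re) :
    HasProd (fun p : Nat.Primes =>
      ∏ᶠ v ∈ HeightOneSpectrum.asIdeal ⁻¹' primesOver (span {((p : ℕ) : ℤ)}) (𝓞 K),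
        (rankinSelbergLocalFactorInvHecke f φ v s)⁻¹) (rankinSelbergEulerProductHecke f φ s) :=
  HasProd.primesOver_regroup_spectrum (hasProd_rankinSelbergEulerProductHecke_of_isFiniteOrder f hφ hs)

end Regroup

/-! ### The assembly step of the Artin formalism -/

section Assembly

variable {K : Type u} [Field K] [NumberField K] {N : ℕ}

/-- **Artin formalism, global step.** Let `f ∈ S₂(Γ₀(N))` be a normalised eigenform
(`IsNewform0`), `φ` a finite-order Hecke character of `K`, `χ₁`, `χ₂` Dirichlet characters and
`re s > 2`. IF at every rational prime `p` the finite product of the inverse Rankin–Selberg local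
factors over the places `v ∣ p` of `K` equals the product of the `p`-Euler factors of
`L(f ⊗ χ₁, s)` and `L(f ⊗ χ₂, s)`, THEN
`rankinSelbergEulerProductHecke f φ s = twistedLSeries f χ₁ s · twistedLSeries f χ₂ s`
(regrouped Euler product on the left, `hasProd_twistedLSeries_mul_twistedLSeries` on the right,
uniqueness of unconditional limits). [cite: Gross2004, §3 (p. 40) and §13 (p. 49)]
[cite: NeukirchANT1999, Ch. VII (10.4) (iv)] -/
theorem rankinSelbergEulerProductHecke_eq_mul_of_local [NeZero N] {f : CuspForm (Gamma0 N) 2}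
    (hf : IsNewform0 f) {φ : HeckeCharacter K} (hφ : φ.IsFiniteOrder) {m₁ m₂ : ℕ}
    (χ₁ : DirichletCharacter ℂ m₁) (χ₂ : DirichletCharacter ℂ m₂) {s : ℂ} (hs : 2 < s.re)
    (hloc : ∀ p : ℕ, p.Prime →
      ∏ᶠ v ∈ HeightOneSpectrum.asIdeal ⁻¹' primesOver (span {(p : ℤ)}) (𝓞 K),
          (rankinSelbergLocalFactorInvHecke f φ v s)⁻¹ =
        (1 - χ₁ (p : ZMod m₁) * cuspCoeff f p * (p : ℂ) ^ (-s) +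
            (if p ∣ N then 0 else (p : ℂ)) * χ₁ (p : ZMod m₁) ^ 2 * ((p : ℂ) ^ (-s)) ^ 2)⁻¹ *
          (1 - χ₂ (p : ZMod m₂) * cuspCoeff f p * (p : ℂ) ^ (-s) +
            (if p ∣ N then 0 else (p : ℂ)) * χ₂ (p : ZMod m₂) ^ 2 * ((p : ℂ) ^ (-s)) ^ 2)⁻¹) :
    rankinSelbergEulerProductHecke f φ s = twistedLSeries f χ₁ s * twistedLSeries f χ₂ s := by
  have h1 := hasProd_rankinSelbergEulerProductHecke_regroup f hφ hs
  have h2 : (fun p : Nat.Primes =>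
      ∏ᶠ v ∈ HeightOneSpectrum.asIdeal ⁻¹' primesOver (span {((p : ℕ) : ℤ)}) (𝓞 K),
        (rankinSelbergLocalFactorInvHecke f φ v s)⁻¹) = fun p : Nat.Primes =>
      (1 - χ₁ ((p : ℕ) : ZMod m₁) * cuspCoeff f p * (p : ℂ) ^ (-s) +
          (if (p : ℕ) ∣ N then 0 else (p : ℂ)) * χ₁ ((p : ℕ) : ZMod m₁) ^ 2 * ((p : ℂ) ^ (-s)) ^ 2)⁻¹ *
        (1 - χ₂ ((p : ℕ) : ZMod m₂) * cuspCoeff f p * (p : ℂ) ^ (-s) +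
          (if (p : ℕ) ∣ N then 0 else (p : ℂ)) * χ₂ ((p : ℕ) : ZMod m₂) ^ 2 * ((p : ℂ) ^ (-s)) ^ 2)⁻¹ :=
    funext fun p => hloc p p.2
  rw [h2] at h1
  exact h1.unique (hf.hasProd_twistedLSeries_mul_twistedLSeries χ₁ χ₂ hs)

/-- **Artin formalism for `φ = ψ_θ ∘ N_{K/ℚ}`, global step** (`K/ℚ` Galois): the conclusion of
`rankinSelbergEulerProductHecke_baseChangeDirichlet_eq` for `(K, f, θ, s)` and ANY second character
`χ₂` follows from the local identities at every rational prime; `ψ_θ ∘ N` has finite order by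
`HeckeCharacter.isFiniteOrder_ofDirichlet` and `IsFiniteOrder.compRelNorm`.
[cite: Gross2004, §3 (p. 40) and §13 (p. 49)] -/
theorem rankinSelbergEulerProductHecke_baseChange_eq_mul_of_local {K : Type} [Field K]
    [NumberField K] [IsGalois ℚ K] [NeZero N] {f : CuspForm (Gamma0 N) 2} (hf : IsNewform0 f)
    {m m₂ : ℕ} [NeZero m] (θ : DirichletCharacter ℂ m) (χ₂ : DirichletCharacter ℂ m₂) {s : ℂ}
    (hs : 2 < s.re)
    (hloc : ∀ p : ℕ, p.Prime →
      ∏ᶠ v ∈ HeightOneSpectrum.asIdeal ⁻¹' primesOver (span {(p : ℤ)}) (𝓞 K),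
          (rankinSelbergLocalFactorInvHecke f ((HeckeCharacter.ofDirichlet θ).compRelNorm K) v s)⁻¹ =
        (1 - θ (p : ZMod m) * cuspCoeff f p * (p : ℂ) ^ (-s) +
            (if p ∣ N then 0 else (p : ℂ)) * θ (p : ZMod m) ^ 2 * ((p : ℂ) ^ (-s)) ^ 2)⁻¹ *
          (1 - χ₂ (p : ZMod m₂) * cuspCoeff f p * (p : ℂ) ^ (-s) +
            (if p ∣ N then 0 else (p : ℂ)) * χ₂ (p : ZMod m₂) ^ 2 * ((p : ℂ) ^ (-s)) ^ 2)⁻¹) :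
    rankinSelbergEulerProductHecke f ((HeckeCharacter.ofDirichlet θ).compRelNorm K) s =
      twistedLSeries f θ s * twistedLSeries f χ₂ s :=
  rankinSelbergEulerProductHecke_eq_mul_of_local hf
    (HeckeCharacter.IsFiniteOrder.compRelNorm K (HeckeCharacter.isFiniteOrder_ofDirichlet θ)) θ χ₂ hs
    hloc

end Assembly

end Literature.NumberTheory.EllipticCurves

end
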